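import Summits.Ventures.PercRepro.SevenThreeStarTable

/-!
# PercRepro — the `(7,3)` cell: the binomial coefficients of the star table (p3, gen 16)

The direct-sum formula `D(S) = Σ_{j ≤ 3} C(lp, j)·Φ_{3−j}(K)` (`SevenThreeCyclic.lean`) and Lemma 27.2's three types
(`SevenThreeNullityTwo.lean`) express `D(S)` as sums over `j ≤ 3`; the star table (`SevenThreeStarTable.lean`) writes
the same quantity with `chooseSub lp base t = C(lp, base − t)`. This file proves the three coefficient identities that
match them, with `m = |K|`, `lp` the number of coloops and `5 ≤ m + lp`:
* `coeff_top`: `Σ_{j<4} C(lp, j)·[m + j = 5] = C(lp, m + lp − 5)`;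
* `coeff_within`: `Σ_{j<4} C(lp, j)·[t + 4 = m + j] = chooseSub lp (m + lp − 4) t` for `t < m`;
* `coeff_cyc`: `Σ_{j<4} C(lp, j)·[t + 3 = m + j] = chooseSub lp (m + lp − 3) t` for `t ≤ m`.
Pure arithmetic (`Nat.choose_symm`, `Nat.choose_eq_zero_of_lt`).
-/

namespace PercRepro

namespace SevenThree

namespace StarCoeff

open Finset

/-- `chooseSub lp base t = C(lp, t')` when `base = lp + t'`... stated as: `chooseSub lp (lp + k) t = C(lp, t − k)`-type
facts are not needed; we use the definition directly. -/
theorem chooseSub_def (lp base j : ℕ) :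
    StarTable.chooseSub lp base j = if j ≤ base then (Nat.choose lp (base - j) : ℤ) else 0 := rfl

/-- The indicator sum over `j < 4` picks the single `j` with `a + j = b` (when `b − a ≤ 3`). -/
theorem sum_range_four_indicator (f : ℕ → ℤ) (a b : ℕ) :
    ∑ j ∈ Finset.range 4, f j * (if a + j = b then 1 else 0) = if a ≤ b ∧ b ≤ a + 3 then f (b - a) else 0 := by
  simp only [Finset.sum_range_succ, Finset.sum_range_zero, zero_add]
  by_cases h0 : a + 0 = b
  · rw [if_pos h0, if_neg (by omega), if_neg (by omega), if_neg (by omega), if_pos ⟨by omega, by omega⟩]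
    have : b - a = 0 := by omega
    rw [this]
    ring
  by_cases h1 : a + 1 = b
  · rw [if_neg h0, if_pos h1, if_neg (by omega), if_neg (by omega), if_pos ⟨by omega, by omega⟩]
    have : b - a = 1 := by omega
    rw [this]
    ring
  by_cases h2 : a + 2 = b
  · rw [if_neg h0, if_neg h1, if_pos h2, if_neg (by omega), if_pos ⟨by omega, by omega⟩]
    have : b - a = 2 := by omega
    rw [this]
    ring
  by_cases h3 : a + 3 = b
  · rw [if_neg h0, if_neg h1, if_neg h2, if_pos h3, if_pos ⟨by omega, by omega⟩]
    have : b - a = 3 := by omega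
    rw [this]
    ring
  · rw [if_neg h0, if_neg h1, if_neg h2, if_neg h3, if_neg (by omega)]
    ring

/-- `C(lp, j) = C(lp, lp − j)` as integers, for `j ≤ lp`. -/
theorem choose_symm_int (lp j : ℕ) (h : j ≤ lp) : (Nat.choose lp j : ℤ) = (Nat.choose lp (lp - j) : ℤ) := by
  rw [Nat.choose_symm h]

/-- **The top coefficient**: `Σ_{j<4} C(lp, j)·[m + j = 5] = C(lp, m + lp − 5)` for `5 ≤ m + lp` and `2 ≤ m`. -/
theorem coeff_top (lp m : ℕ) (hm : 5 ≤ m + lp) (hm2 : 2 ≤ m) :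
    ∑ j ∈ Finset.range 4, (Nat.choose lp j : ℤ) * (if m + j = 5 then 1 else 0) = (Nat.choose lp (m + lp - 5) : ℤ) := by
  rw [sum_range_four_indicator (fun j => (Nat.choose lp j : ℤ)) m 5]
  by_cases h : m ≤ 5
  · rw [if_pos ⟨h, by omega⟩]
    have h1 : 5 - m ≤ lp := by omega
    rw [choose_symm_int lp (5 - m) h1]
    congr 2
    omega
  · rw [if_neg (fun hh => h hh.1)]
    rw [Nat.choose_eq_zero_of_lt (by omega : lp < m + lp - 5)]
    rfl

/-- **The within-class coefficient**: `Σ_{j<4} C(lp, j)·[t + 4 = m + j] = chooseSub lp (m + lp − 4) t` for `t < m`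
and `4 ≤ m + lp`. -/
theorem coeff_within (lp m t : ℕ) (hm : 4 ≤ m + lp) (ht : t < m) :
    ∑ j ∈ Finset.range 4, (Nat.choose lp j : ℤ) * (if m + j = t + 4 then 1 else 0) =
      StarTable.chooseSub lp (m + lp - 4) t := by
  rw [sum_range_four_indicator (fun j => (Nat.choose lp j : ℤ)) m (t + 4), chooseSub_def]
  by_cases hlow : m ≤ t + 4
  · rw [if_pos ⟨hlow, by omega⟩]
    by_cases hup : t ≤ m + lp - 4
    · rw [if_pos hup]
      have h1 : t + 4 - m ≤ lp := by omega
      rw [choose_symm_int lp (t + 4 - m) h1]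
      congr 2
      omega
    · rw [if_neg hup]
      rw [Nat.choose_eq_zero_of_lt (by omega : lp < t + 4 - m)]
      rfl
  · rw [if_neg (fun hh => hlow hh.1), if_pos (by omega)]
    rw [Nat.choose_eq_zero_of_lt (by omega : lp < m + lp - 4 - t)]
    rfl

/-- **The cyclic coefficient**: `Σ_{j<4} C(lp, j)·[t + 3 = m + j] = chooseSub lp (m + lp − 3) t` for `t ≤ m` and
`3 ≤ m + lp`. -/
theorem coeff_cyc (lp m t : ℕ) (hm : 3 ≤ m + lp) (ht : t ≤ m) :
    ∑ j ∈ Finset.range 4, (Nat.choose lp j : ℤ) * (if m + j = t + 3 then 1 else 0) =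
      StarTable.chooseSub lp (m + lp - 3) t := by
  rw [sum_range_four_indicator (fun j => (Nat.choose lp j : ℤ)) m (t + 3), chooseSub_def]
  by_cases hlow : m ≤ t + 3
  · rw [if_pos ⟨hlow, by omega⟩]
    by_cases hup : t ≤ m + lp - 3
    · rw [if_pos hup]
      have h1 : t + 3 - m ≤ lp := by omega
      rw [choose_symm_int lp (t + 3 - m) h1]
      congr 2
      omega
    · rw [if_neg hup]
      rw [Nat.choose_eq_zero_of_lt (by omega : lp < t + 3 - m)]
      rfl
  · rw [if_neg (fun hh => hlow hh.1), if_pos (by omega)]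
    rw [Nat.choose_eq_zero_of_lt (by omega : lp < m + lp - 3 - t)]
    rfl

/-- `sumTo n f = Σ_{v ∈ range (n + 1)} f v` (the integer version). -/
theorem sumTo_eq_sum (n : ℕ) (f : ℕ → ℤ) : StarTable.sumTo n f = ∑ v ∈ Finset.range (n + 1), f v := by
  induction n with
  | zero => simp [StarTable.sumTo]
  | succ n ih => rw [StarTable.sumTo, ih, Finset.sum_range_succ _ (n + 1)]

/-- `withinSum` as a list sum of range sums. -/
theorem withinSum_eq (lp nu : ℕ) (cs : List ℕ) :
    StarTable.withinSum lp nu cs =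
      (cs.map (fun c => ∑ j ∈ Finset.range (c + 1),
        (if 2 ≤ j then (Nat.choose c j : ℤ) * StarTable.chooseSub lp (nu + 1) j else 0))).sum := by
  induction cs with
  | nil => rfl
  | cons c cs ih => rw [StarTable.withinSum, ih, List.map_cons, List.sum_cons, sumTo_eq_sum]

end StarCoeff

end SevenThree

end PercRepro
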